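/-
Copyright (c) 2026 the pub-hodgecm-mathlib formalisation cell (harness21).  Prover seat hodgecm-mathlib-A-p19 (g29): road «S3-ram» (LEAD F0P3a-plan (g13); owner ∕ (α) keeper
F0P3a-p06 (g16) texts v2; (Cnt2′) chair F0P3a-p07 (g15) plan (Z-Aeven)∕(P-Aeven), RULINGS (16)(b), (18)): THE A-EVEN HYPERBOLIC BLOCK-LAW CELLS, CLOSED; 2026-09-02.
-/
import Literature.NumberTheory.Rogawski1990.TypeTwoRamifiedHyperbolicCellsAEvenOfVertexCensus                 -- ★ p849529 (this seat): the cells modulo the per-vertex top census; brings ★ p849294 ∕ p849413 ∕ p849287 ∕ p849335 ∕ p849372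
import Literature.NumberTheory.Rogawski1990.DepthZeroKappaTransferTypeTwoRamifiedHyperbolicVertexCensusTopRegion  -- ★ p849611 (this seat): `hyperbolicVertexCensus_top` (glue (g1)–(g3))
import Literature.NumberTheory.Rogawski1990.DepthZeroKappaTransferTypeTwoRamifiedWSideLatticeCurrencyTopKindsCentredJunction  -- ★ p849536 (F0P3a-p05 (g18) XIII-b): `two_mul_ncard_rootRegion_shell_class_eq_of_top_of_even_depth_ramified`
import Literature.NumberTheory.Automorphic.LineStrataMeasure                                                   -- ★ `red_ne_zero_iff_valuation_eq_one` (the pm cell's class constant is a unit)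
import HarnessLib

/-!
# The A-even hyperbolic cells of the (Cnt2′) block law, CLOSED (Rogawski 1990 §4.9; Kottwitz 1986 §3; Labesse–Langlands 1979 §2)

Topic `NumberTheory/Rogawski1990`; namespaces `Literature.NumberTheory.Rogawski1990.TypeOneRamifiedJunction` (§0, generic `K`) and `Literature.NumberTheory.Rogawski1990.BlockLawHyp`
(§1, the CM place).  THEOREMS ONLY (no definition, no instance, no notation, no named fact, no `sorry`); kernel lane `--supports stmt-HodgeConjecture-24833`.  Cell `pub/hodgecm-mathlib`
(D-0151), crux H413 `HCCMStratifiedTransfer`; road «S3-ram» (Literature seeding, count-neutral); the (α) BLOCK-LAW skeleton of the (Cnt2′) type-(2) assembly (keeper F0P3a-p06 (g16),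
ZERO file v2.4 847a883e ∕ PM file; texts `stub_Zhyp_zero_even_A` 587a8c74, `stub_Zhyp_pm_even_A` 41fe9341), chair F0P3a-p07 (g15) ASSEMBLY PLAN 05:03:10Z (Z-Aeven)∕(P-Aeven),
RULING (18) (the A-even pair = this seat).

* §0 `TypeOneRamifiedJunction.hyperbolicVertexCensus_top_sum` — the class-blind form of ★ p849611 `hyperbolicVertexCensus_top` (`#E = 0`, `#P + #M = q²` at every top root vertex);
* §1 **`BlockLawHyp.zhyp_zero_even_A_ram`** and **`BlockLawHyp.zhyp_pm_even_A_ram`** — THE KEEPER'S CELLS, statements = the keeper's v2 texts VERBATIM (all J0diff ∕ (F) frame binders,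
  the unused ones `_`-named by `intro`), conclusions `(#A : ℂ) = (q + 1)·Σ_{i<mA} q^{2i}` and `#A₊ = #A₋ = (q + 1)∕2 · q^{2mA}`.  PROOF (composition of ★ heads, no new mathematics):
  `s` (★ `exists_units_mul_oneByOne_eq_one`), `k` at depth `2n − 1` (★ p849294 `exists_centre_forall_v_rerootedCentred_sub_one_le_of_even_ram`), `γ′ = ι(B₀, 1)` (★ p849231),
  `B₀ ∈ U(σ_w, !![0,1;1,0])`, rootless, `|disc| = exp(−2·2n)` (★ p849231 ∕ p849259), TOP `|½tr B₀ − 1| ≤ |ϖ^{2n}|` (★ chair dictionary (A)), empty top `W`-ball (★ F0P3a-p05 part X ∘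
  ★ p849413 §1 transport), `#R = q + 1` (★ p849413), a residual non-square `ε` and `#𝓀_w = N(v)` (★ p849529 §0, ★ `natCard_residueField_eq_of_ramified`); then the per-vertex
  census ★ p849611 `hyperbolicVertexCensus_top` (zero: §0 at `c₁ := 1`; pm: at `c₁ := c`, kind `Q v :≡ ¬Pin v ∧ Qbig_(−c) v` with `2·#{v ∈ R ∣ Q v} = q + 1` = ★ XIII-b p849536 at
  `c₀ := −c`) feeds ★ p849529 `zhyp_{zero,pm}_even_A_ram_of_topVertexCensus`.  Keeper: `stub_Zhyp_zero_even_A := by exact BlockLawHyp.zhyp_zero_even_A_ram L H' hH' w hw he hH'w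
  _hH'i h2 ϖ hϖ hσϖ A hA hframe`, `stub_Zhyp_pm_even_A := by exact BlockLawHyp.zhyp_pm_even_A_ram …` (same argument list).
HONEST LABEL: HC_CM is proved only modulo the 2 remaining named inputs (hLiu418 24832, h413 24833) until rung 0 closes; nothing printed is asserted here (composition of ★ lattice
counts at one place); «S3-ram» has no books consequence.

## References
* [Rogawski1990] J. D. Rogawski, *Automorphic Representations of Unitary Groups in Three Variables*, Ann. of Math. Stud. 123 (1990), §4.9 Prop. 4.9.1 (a)(b) p. 55, Lemma 4.9.3 p. 56.
* [Kottwitz1986] R. E. Kottwitz, *Base change for unit elements of Hecke algebras*, Compositio Math. 60 (1986), §3.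
* [LabesseLanglands1979] J.-P. Labesse, R. P. Langlands, *L-indistinguishability for SL(2)*, Canad. J. Math. 31 (1979), §2 Lemma 2.1 p. 8.
* [BruhatTits1972] F. Bruhat, J. Tits, *Groupes réductifs sur un corps local I*, Publ. Math. IHÉS 41 (1972), §10.
-/

set_option autoImplicit false

noncomputable section

/-! ## §0 The class-blind per-vertex census at the top (generic `K`) -/

namespace Literature.NumberTheory.Rogawski1990.TypeOneRamifiedJunction

open scoped Valued WithZero Matrix MatrixGroups
open Polynomial Classical SimpleGraph
open Literature.NumberTheory.Automorphic Literature.NumberTheory.Automorphic.HermitianLattice Literature.NumberTheory.Automorphic.UnitaryLatticeTree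
open Literature.NumberTheory.Automorphic.UnitaryGroup

variable {K : Type*} [Field K] [Valued K ℤᵐ⁰] {σ : K →+* K} {ϖ : K}

set_option maxHeartbeats 1600000 in
-- budget only: statement-heavy lattice tokens.
/-- **CLASS-BLIND FORM of ★ `hyperbolicVertexCensus_top`**: at every top root vertex `#E(v) = 0` and `#P(v) + #M(v) = q²` (the two kinds pooled) — the `hE0 ∕ hPM`
hypotheses of ★ `BlockLawHyp.zhyp_zero_even_A_ram_of_topVertexCensus`. [cite: Kottwitz1986, §3] [cite: Rogawski1990, §4.9 Prop. 4.9.1 (b) p. 55] -/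
theorem hyperbolicVertexCensus_top_sum [IsPrincipalIdealRing 𝒪[K]]
    (hσ : ∀ x, σ (σ x) = x) (hvσ : ∀ a, Valued.v (σ a) = Valued.v a) (hσϖ : σ ϖ = -ϖ)
    (hϖ : Valued.v ϖ = WithZero.exp (-1 : ℤ)) (hres : ∀ x : K, Valued.v x ≤ 1 → Valued.v (σ x - x) < 1) (h2 : Valued.v (2 : K) = 1)
    (hnorm : ∀ u : K, σ u = u → Valued.v (u - 1) < 1 → ∃ z : K, z * σ z = u ∧ Valued.v (z - 1) ≤ Valued.v (u - 1))
    [Fintype 𝓀[K]] [DecidableEq 𝓀[K]] [ValuativeRel K] [(Valued.v : Valuation K ℤᵐ⁰).Compatible]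
    (γ : unitaryGroupOfForm σ ((StdForm.antidiagonal 3).over K)) (B₀ : GL (Fin 2) K) (hγ : (γ : GL (Fin 3) K) = endoGL (B₀, (1 : GL (Fin 1) K)))
    (hγU : B₀ ∈ unitaryGroupOfForm σ (!![(0 : K), 1; 1, 0] : Matrix (Fin 2) (Fin 2) K))
    {d₀ : ℕ} (hd3 : 3 ≤ d₀) (hodd : Odd d₀)
    (hBm : ∀ i j, Valued.v (((B₀ : Matrix (Fin 2) (Fin 2) K) - 1) i j) ≤ Valued.v ϖ ^ d₀)
    (hdisc : Valued.v ((B₀ : Matrix (Fin 2) (Fin 2) K).trace ^ 2 - 4 * (B₀ : Matrix (Fin 2) (Fin 2) K).det) < Valued.v ϖ ^ (2 * d₀))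
    (hα : Valued.v ((B₀ : Matrix (Fin 2) (Fin 2) K).trace / 2 - 1) ≤ Valued.v (ϖ ^ (d₀ + 1)))
    (htop : {B : Submodule 𝒪[K] (Fin 2 → K) | IsSelfDualLattice σ ϖ (!![(0 : K), 1; 1, 0] : Matrix (Fin 2) (Fin 2) K) B ∧ mapGL B₀ B = B ∧
        B.map ((Matrix.toLin' ((B₀ : Matrix (Fin 2) (Fin 2) K) - ((B₀ : Matrix (Fin 2) (Fin 2) K).trace / 2) • (1 : Matrix (Fin 2) (Fin 2) K))).restrictScalars 𝒪[K]) ≤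
          scaleLattice (ϖ ^ (d₀ + 1)) B} = ∅)
    (hRfin : Set.Finite {v : {M : Submodule 𝒪[K] (Fin 3 → K) // IsVertex σ ϖ ((StdForm.antidiagonal 3).over K) M} | latticeGraphIso σ ϖ ((StdForm.antidiagonal 3).over K) γ v = v ∧ IsSelfDualLattice σ ϖ ((StdForm.antidiagonal 3).over K) v.1 ∧ v.1.map ((Matrix.toLin' (((γ : GL (Fin 3) K) : Matrix (Fin 3) (Fin 3) K) - 1)).restrictScalars 𝒪[K]) ≤ scaleLattice (ϖ ^ d₀) v.1})
    (c₁ ε : K) (hc₁ : Valued.v c₁ = 1) (hεv : Valued.v ε = 1) (hε : ∀ z : K, Valued.v z ≤ 1 → Valued.v (z ^ 2 - ε) = 1)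
    (nc₁ : 𝒪[K]) (hnc₁ : (nc₁ : K) = -c₁) :
    ∀ v ∈ {v : {M : Submodule 𝒪[K] (Fin 3 → K) // IsVertex σ ϖ ((StdForm.antidiagonal 3).over K) M} | latticeGraphIso σ ϖ ((StdForm.antidiagonal 3).over K) γ v = v ∧ IsSelfDualLattice σ ϖ ((StdForm.antidiagonal 3).over K) v.1 ∧ v.1.map ((Matrix.toLin' (((γ : GL (Fin 3) K) : Matrix (Fin 3) (Fin 3) K) - 1)).restrictScalars 𝒪[K]) ≤ scaleLattice (ϖ ^ d₀) v.1},
      ({w | w ∈ {w | ∃ c, ((latticeGraph σ ϖ ((StdForm.antidiagonal 3).over K)).Adj v c ∧ (latticeGraph σ ϖ ((StdForm.antidiagonal 3).over K)).dist ⟨stdLattice K 3, 0, isSelfDualLattice_stdLattice_three_of_v hϖ⟩ c = (latticeGraph σ ϖ ((StdForm.antidiagonal 3).over K)).dist ⟨stdLattice K 3, 0, isSelfDualLattice_stdLattice_three_of_v hϖ⟩ v + 1 ∧ latticeGraphIso σ ϖ ((StdForm.antidiagonal 3).over K) γ c = c) ∧ ((latticeGraph σ ϖ ((StdForm.antidiagonal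 3).over K)).Adj c w ∧ (latticeGraph σ ϖ ((StdForm.antidiagonal 3).over K)).dist ⟨stdLattice K 3, 0, isSelfDualLattice_stdLattice_three_of_v hϖ⟩ w = (latticeGraph σ ϖ ((StdForm.antidiagonal 3).over K)).dist ⟨stdLattice K 3, 0, isSelfDualLattice_stdLattice_three_of_v hϖ⟩ c + 1 ∧ latticeGraphIso σ ϖ ((StdForm.antidiagonal 3).over K) γ w = w)} ∧ (¬ w.1.map ((Matrix.toLin' (((γ : GL (Fin 3) K) : Matrix (Fin 3) (Fin 3) K) - 1)).restrictScalars 𝒪[K]) ≤ scaleLattice (ϖ ^ d₀) w.1 ∧ (w.1.map ((Matrix.toLin' (((γ : GL (Fin 3) K) : Matrix (Fin 3) (Fin 3) K) - 1)).restrictScalars 𝒪[K]) ≤ scaleLattice (ϖ ^ (d₀ - 1)) w.1 ∧ ¬ w.1.map ((Matrix.toLin' (((γ : GL (Fin 3) K) : Matrix (Fin 3) (Fin 3) K) - 1)).restrictScalars 𝒪[K]) ≤ scaleLattice (ϖ ^ d₀) w.1))}).ncard = 0 ∧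
      ({w | w ∈ {w | ∃ c, ((latticeGraph σ ϖ ((StdForm.antidiagonal 3).over K)).Adj v c ∧ (latticeGraph σ ϖ ((StdForm.antidiagonal 3).over K)).dist ⟨stdLattice K 3, 0, isSelfDualLattice_stdLattice_three_of_v hϖ⟩ c = (latticeGraph σ ϖ ((StdForm.antidiagonal 3).over K)).dist ⟨stdLattice K 3, 0, isSelfDualLattice_stdLattice_three_of_v hϖ⟩ v + 1 ∧ latticeGraphIso σ ϖ ((StdForm.antidiagonal 3).over K) γ c = c) ∧ ((latticeGraph σ ϖ ((StdForm.antidiagonal 3).over K)).Adj c w ∧ (latticeGraph σ ϖ ((StdForm.antidiagonal 3).over K)).dist ⟨stdLattice K 3, 0, isSelfDualLattice_stdLattice_three_of_v hϖ⟩ w = (latticeGraph σ ϖ ((StdForm.antidiagonal 3).over K)).dist ⟨stdLattice K 3, 0, isSelfDualLattice_stdLattice_three_of_v hϖ⟩ c + 1 ∧ latticeGraphIso σ ϖ ((StdForm.antidiagonal 3).over K) γ w = w)} ∧ (¬ w.1.map ((Matrix.toLin' (((γ : GL (Fin 3) K) : Matrix (Fin 3) (Fin 3) K) - 1)).restrictScalars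 𝒪[K]) ≤ scaleLattice (ϖ ^ d₀) w.1 ∧ (w.1.map ((Matrix.toLin' (((γ : GL (Fin 3) K) : Matrix (Fin 3) (Fin 3) K) - 1)).restrictScalars 𝒪[K]) ≤ scaleLattice (ϖ ^ (d₀ - 2)) w.1 ∧ ¬ w.1.map ((Matrix.toLin' (((γ : GL (Fin 3) K) : Matrix (Fin 3) (Fin 3) K) - 1)).restrictScalars 𝒪[K]) ≤ scaleLattice (ϖ ^ (d₀ - 1)) w.1) ∧ ∃ y ∈ w.1, ∃ a : K, Valued.v a = 1 ∧ Valued.v ((ϖ ^ (d₀ - 2))⁻¹ * pairing σ ((StdForm.antidiagonal 3).over K) y ((((γ : GL (Fin 3) K) : Matrix (Fin 3) (Fin 3) K) - 1) *ᵥ y) - (c₁) * a ^ 2) < 1)}).ncard +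
        ({w | w ∈ {w | ∃ c, ((latticeGraph σ ϖ ((StdForm.antidiagonal 3).over K)).Adj v c ∧ (latticeGraph σ ϖ ((StdForm.antidiagonal 3).over K)).dist ⟨stdLattice K 3, 0, isSelfDualLattice_stdLattice_three_of_v hϖ⟩ c = (latticeGraph σ ϖ ((StdForm.antidiagonal 3).over K)).dist ⟨stdLattice K 3, 0, isSelfDualLattice_stdLattice_three_of_v hϖ⟩ v + 1 ∧ latticeGraphIso σ ϖ ((StdForm.antidiagonal 3).over K) γ c = c) ∧ ((latticeGraph σ ϖ ((StdForm.antidiagonal 3).over K)).Adj c w ∧ (latticeGraph σ ϖ ((StdForm.antidiagonal 3).over K)).dist ⟨stdLattice K 3, 0, isSelfDualLattice_stdLattice_three_of_v hϖ⟩ w = (latticeGraph σ ϖ ((StdForm.antidiagonal 3).over K)).dist ⟨stdLattice K 3, 0, isSelfDualLattice_stdLattice_three_of_v hϖ⟩ c + 1 ∧ latticeGraphIso σ ϖ ((StdForm.antidiagonal 3).over K) γ w = w)} ∧ (¬ w.1.map ((Matrix.toLin' (((γ : GL (Fin 3) K) : Matrix (Fin 3) (Fin 3) K) - 1)).restrictScalars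 𝒪[K]) ≤ scaleLattice (ϖ ^ d₀) w.1 ∧ (w.1.map ((Matrix.toLin' (((γ : GL (Fin 3) K) : Matrix (Fin 3) (Fin 3) K) - 1)).restrictScalars 𝒪[K]) ≤ scaleLattice (ϖ ^ (d₀ - 2)) w.1 ∧ ¬ w.1.map ((Matrix.toLin' (((γ : GL (Fin 3) K) : Matrix (Fin 3) (Fin 3) K) - 1)).restrictScalars 𝒪[K]) ≤ scaleLattice (ϖ ^ (d₀ - 1)) w.1) ∧ ¬ (∃ y ∈ w.1, ∃ a : K, Valued.v a = 1 ∧ Valued.v ((ϖ ^ (d₀ - 2))⁻¹ * pairing σ ((StdForm.antidiagonal 3).over K) y ((((γ : GL (Fin 3) K) : Matrix (Fin 3) (Fin 3) K) - 1) *ᵥ y) - (c₁) * a ^ 2) < 1))}).ncard = Fintype.card 𝓀[K] ^ 2 := by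
  intro v hv
  obtain ⟨hE, h1, h2⟩ := hyperbolicVertexCensus_top hσ hvσ hσϖ hϖ hres h2 hnorm γ B₀ hγ hγU hd3 hodd hBm hdisc hα htop hRfin c₁ ε hc₁ hεv hε nc₁ hnc₁ v hv
  by_cases hQ : (¬ (∀ y ∈ v.1, y 1 = 0 → ((((γ : GL (Fin 3) K) : Matrix (Fin 3) (Fin 3) K) - ((B₀ : Matrix (Fin 2) (Fin 2) K).trace / 2) • (1 : Matrix (Fin 3) (Fin 3) K)) *ᵥ y) ∈ scaleLattice (ϖ ^ (d₀ + 1)) v.1) ∧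
        ∃ y ∈ v.1, y 1 = 0 ∧ ∃ a : K, Valued.v a = 1 ∧ Valued.v ((ϖ ^ d₀)⁻¹ * pairing σ ((StdForm.antidiagonal 3).over K) y ((((γ : GL (Fin 3) K) : Matrix (Fin 3) (Fin 3) K) - ((B₀ : Matrix (Fin 2) (Fin 2) K).trace / 2) • (1 : Matrix (Fin 3) (Fin 3) K)) *ᵥ y) - (nc₁ : K) * a ^ 2) < 1)
  · obtain ⟨hP, hM⟩ := h1 hQ
    exact ⟨hE, by rw [hP, hM, add_zero]⟩
  · obtain ⟨hP, hM⟩ := h2 hQ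
    exact ⟨hE, by rw [hP, hM, zero_add]⟩

end Literature.NumberTheory.Rogawski1990.TypeOneRamifiedJunction

/-! ## §1 The keeper's A-even hyperbolic cells at the CM place -/

namespace Literature.NumberTheory.Rogawski1990.BlockLawHyp

open NumberField IsDedekindDomain Matrix Polynomial ValuativeRel
open Literature.NumberTheory.Automorphic Literature.NumberTheory.Automorphic.UnitaryGroup
open Literature.NumberTheory.Automorphic.UnitaryLatticeTree Literature.NumberTheory.Automorphic.HermitianLattice
open Literature.NumberTheory.GaloisRepresentations Literature.NumberTheory.Automorphic.IntegralReduction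
open Literature.NumberTheory.Rogawski1990 Literature.NumberTheory.Rogawski1990.TypeOneRamifiedJunction
open scoped Matrix MatrixGroups ValuativeRel WithZero

set_option maxHeartbeats 3200000 in
-- budget only: the keeper's statement-heavy socket text (verbatim) and the token-heavy ★ heads composed.
/-- **THE KEEPER'S CELL `stub_Zhyp_zero_even_A`, CLOSED** (regime A-even `N = 2n = m`, `n = mA + 1`, row `0`, hyperbolic literal `ι(ĝ_w, û_w)`): `(#A : ℂ) = (q + 1)·Σ_{i<mA} q^{2i}` —
★ `zhyp_zero_even_A_ram_of_topVertexCensus` ∘ ★ `hyperbolicVertexCensus_top_sum` at the re-rooted literal `ι(k⁻¹(s·ĝ_w)k, 1)` of block depth `2n − 1`. [cite: Rogawski1990, §4.9 Prop. 4.9.1 (a) p. 55, Lemma 4.9.3 p. 56]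
[cite: Kottwitz1986, §3] [cite: LabesseLanglands1979, §2 Lemma 2.1 p. 8] -/
theorem zhyp_zero_even_A_ram
    (L : Type) [Field L] [NumberField L] [IsCMField L] (H' : Matrix (Fin 3) (Fin 3) L)
    {v : HeightOneSpectrum (𝓞 ↥(maximalRealSubfield L))}
    (_hH' : (H'.map (cmConjRingHom L)).transpose = H') (w : PlacesOver L v)
    (hw : IsCMField.complexConj L • w.1 = w.1) (he : v.asIdeal.ramificationIdx' w.1.asIdeal ≠ 1)
    (hH'w : IsUnit (placeForm H' w.1)) (_hH'i : hH'w.unit ∈ glInt 3 (w.1.adicCompletion L))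
    (h2 : IsUnit (2 : 𝒪[(w.1.adicCompletion L)]))
    (ϖ : w.1.adicCompletion L) (hϖ : Valued.v ϖ = WithZero.exp (-1 : ℤ)) (hσϖ : galAdicCompletionMap (L := L) (IsCMField.complexConj L) hw ϖ = -ϖ)
    (A : GL (Fin 3) (w.1.adicCompletion L)) (_hA : A ∈ glInt 3 (w.1.adicCompletion L))
    (_hframe : placeForm H' w.1 = (-(placeForm H' w.1).det) • formCongr (galAdicCompletionMap (L := L) (IsCMField.complexConj L) hw) A ((StdForm.antidiagonal 3).over (w.1.adicCompletion L))) :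

    ∀ ⦃γH : ((cmDatum L 2 (Matrix.of fun i j : Fin 2 => if i.val + j.val + 1 = 2 then (1 : L) else 0)).Local v × (cmDatum L 1 (Matrix.of fun i j : Fin 1 => if i.val + j.val + 1 = 1 then (1 : L) else 0)).Local v)⦄,
      (∀ i j : Fin 2, Valued.v (((((γH.1.val : GL (Fin 2) (UnitaryGroup.LocalRing L v)).val.map (Pi.evalRingHom (fun w' : PlacesOver L v => w'.1.adicCompletion L) w))) - 1) i j) ≤ Valued.v (ϖ ^ 2)) → Valued.v (finGammaTwo L v γH w - 1) ≤ Valued.v (ϖ ^ 2) → IsLocalGRegular L v γH →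
      (¬ ∃ x : (w.1.adicCompletion L), ((((γH.1.val : GL (Fin 2) (UnitaryGroup.LocalRing L v)).val.map (Pi.evalRingHom (fun w' : PlacesOver L v => w'.1.adicCompletion L) w))).charpoly).IsRoot x) → ∀ ⦃n : ℕ⦄,
      Valued.v ((((γH.1.val : GL (Fin 2) (UnitaryGroup.LocalRing L v)).val.map (Pi.evalRingHom (fun w' : PlacesOver L v => w'.1.adicCompletion L) w))).trace ^ 2 - 4 * (((γH.1.val : GL (Fin 2) (UnitaryGroup.LocalRing L v)).val.map (Pi.evalRingHom (fun w' : PlacesOver L v => w'.1.adicCompletion L) w))).det) = WithZero.exp (-((2 * (2 * n) : ℕ) : ℤ)) → 1 ≤ n →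
      ∀ (m : ℕ), Valued.v (((finCharpolyTwo L v γH).eval (finGammaTwo L v γH)) w) =
          Valued.v ((toPlace v w (HeckeCharacter.uniformizer ↥(maximalRealSubfield L) v : v.adicCompletion ↥(maximalRealSubfield L))) ^ m) →
        ∀ β : (v.adicCompletion ↥(maximalRealSubfield L))ˣ, toPlace v w (β : v.adicCompletion ↥(maximalRealSubfield L)) =
          -(((finCharpolyTwo L v γH).eval (finGammaTwo L v γH)) w *
              (finGammaTwo L v γH w ^ 2 +
                ((γH.1.val.val : Matrix (Fin 2) (Fin 2) (LocalRing L v)).map (Pi.evalRingHom (fun w' : PlacesOver L v => w'.1.adicCompletion L) w)).det)) /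
            (2 * finGammaTwo L v γH w ^ 2 *
              ((γH.1.val.val : Matrix (Fin 2) (Fin 2) (LocalRing L v)).map (Pi.evalRingHom (fun w' : PlacesOver L v => w'.1.adicCompletion L) w)).det) →
        ∀ (P₁ : GL (Fin 3) (w.1.adicCompletion L)) (d : Fin 2 → (w.1.adicCompletion L)) (η : (w.1.adicCompletion L)) (γ₁ : GL (Fin 2) (w.1.adicCompletion L)),
        P₁ ∈ glInt 3 (w.1.adicCompletion L) →
        formCongr (galAdicCompletionMap (L := L) (IsCMField.complexConj L) hw) P₁ (placeForm (Matrix.of fun i j : Fin 3 => if i.val + j.val + 1 = 3 then (1 : L) else 0) w.1) = !![(Matrix.diagonal d) 0 0, 0, (Matrix.diagonal d) 0 1; 0, η, 0; (Matrix.diagonal d) 1 0, 0, (Matrix.diagonal d) 1 1] →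
        (∀ i, Valued.v (d i) = 1) → (∀ i, (galAdicCompletionMap (L := L) (IsCMField.complexConj L) hw) (d i) = d i) →
        (∀ z : (w.1.adicCompletion L), Valued.v z ≤ 1 → Valued.v (d 0 + d 1 * ((galAdicCompletionMap (L := L) (IsCMField.complexConj L) hw) z * z)) = 1) →
        (∀ z : (w.1.adicCompletion L), Valued.v z ≤ 1 → Valued.v (d 0 * ((galAdicCompletionMap (L := L) (IsCMField.complexConj L) hw) z * z) + d 1) = 1) →
        (galAdicCompletionMap (L := L) (IsCMField.complexConj L) hw) η = η → Valued.v η = 1 →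
        (∀ i j, Valued.v (((γ₁ : Matrix (Fin 2) (Fin 2) (w.1.adicCompletion L)) - 1) i j) ≤ Valued.v (ϖ ^ 2)) →
        γ₁ ∈ unitaryGroupOfForm (galAdicCompletionMap (L := L) (IsCMField.complexConj L) hw) (Matrix.diagonal d) →
        (γ₁ : Matrix (Fin 2) (Fin 2) (w.1.adicCompletion L)).charpoly = (((γH.1.val : GL (Fin 2) (UnitaryGroup.LocalRing L v)).val.map (Pi.evalRingHom (fun w' : PlacesOver L v => w'.1.adicCompletion L) w))).charpoly →
        Valued.v ((γ₁ : Matrix (Fin 2) (Fin 2) (w.1.adicCompletion L)).trace ^ 2 - 4 * (γ₁ : Matrix (Fin 2) (Fin 2) (w.1.adicCompletion L)).det) = WithZero.exp (-((2 * (2 * n) : ℕ) : ℤ)) →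
        (¬ ∃ x : (w.1.adicCompletion L), ((γ₁ : Matrix (Fin 2) (Fin 2) (w.1.adicCompletion L)).charpoly).IsRoot x) →
        (¬ ∃ t : (w.1.adicCompletion L), t * (galAdicCompletionMap (L := L) (IsCMField.complexConj L) hw) t = η) →
          ∀ (mA : ℕ), n = mA + 1 → m = 2 * n →
          ({M : Submodule (Valued.integer (w.1.adicCompletion L)) (Fin 3 → (w.1.adicCompletion L)) | IsSelfDualLattice (galAdicCompletionMap (L := L) (IsCMField.complexConj L) hw) ϖ (placeForm (Matrix.of fun i j : Fin 3 => if i.val + j.val + 1 = 3 then (1 : L) else 0) w.1) M ∧ mapGL (endoGL (((localNonsplitEquiv (IsCMField.complexConj L) (Matrix.of fun i j : Fin 2 => if i.val + j.val + 1 = 2 then (1 : L) else 0) (IsCMField.complexConj_ne_one L) w hw γH.1).val : GL (Fin 2) (w.1.adicCompletion L)), ((localNonsplitEquiv (IsCMField.complexConj L) (Matrix.of fun i j : Fin 1 => if i.val + j.val + 1 = 1 then (1 : L) else 0) (IsCMField.complexConj_ne_one L) w hw γH.2).val : GL (Fin 1) (w.1.adicCompletion L)))) M = M ∧ M.map ((Matrix.toLin'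 (((endoGL (((localNonsplitEquiv (IsCMField.complexConj L) (Matrix.of fun i j : Fin 2 => if i.val + j.val + 1 = 2 then (1 : L) else 0) (IsCMField.complexConj_ne_one L) w hw γH.1).val : GL (Fin 2) (w.1.adicCompletion L)), ((localNonsplitEquiv (IsCMField.complexConj L) (Matrix.of fun i j : Fin 1 => if i.val + j.val + 1 = 1 then (1 : L) else 0) (IsCMField.complexConj_ne_one L) w hw γH.2).val : GL (Fin 1) (w.1.adicCompletion L))) : GL (Fin 3) (w.1.adicCompletion L)) : Matrix (Fin 3) (Fin 3) (w.1.adicCompletion L)) - 1)).restrictScalars (Valued.integer (w.1.adicCompletion L))) ≤ scaleLattice (ϖ ^ 2) M}.ncard : ℂ) =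
            ((Ideal.absNorm v.asIdeal : ℂ) + 1) * ∑ i ∈ Finset.range mA, (Ideal.absNorm v.asIdeal : ℂ) ^ (2 * i) := by
  intro γH hblk hu2 _hreg hirr n hdisc hn m hm β hβ _P₁ _d _η _γ₁ _hP₁ _hform _hd1 _hdσ _han₀ _han₁ _hση _hηv _hγ2 _hγU _hχ _hdiscγ _hirrγ _hηN mA hnA hmN
  classical
  -- THE CM DRESS: `σ_w` an involution preserving `|·|`, residually trivial with norms, `|2| = 1`, PIR integers, `#𝓀_w = N(v)`, a residual non-square `ε`
  have hc1 : IsCMField.complexConj L ≠ 1 := IsCMField.complexConj_ne_one L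
  have h2v : Valued.v (2 : (w.1.adicCompletion L)) = 1 := (isUnit_two_integer_iff_valued_eq_one L w.1).1 h2
  have hσσ : ∀ z : (w.1.adicCompletion L), (galAdicCompletionMap (L := L) (IsCMField.complexConj L) hw) ((galAdicCompletionMap (L := L) (IsCMField.complexConj L) hw) z) = z :=
    galAdicCompletionMap_galAdicCompletionMap_of_smul_eq (IsCMField.complexConj L) w hc1 hw
  have hvσ : ∀ z : (w.1.adicCompletion L), Valued.v ((galAdicCompletionMap (L := L) (IsCMField.complexConj L) hw) z) = Valued.v z := fun z =>
    valued_galAdicCompletionMap (L := L) (IsCMField.complexConj L) hw z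
  obtain ⟨-, -, -, hres, hnorm⟩ := ramifiedBlock_adicCompletion L v w hw he h2v
  haveI : Fintype (Valued.ResidueField (w.1.adicCompletion L)) := Fintype.ofFinite _
  haveI := isPrincipalIdealRing_integer_adicCompletion L v w
  have hq : ((Fintype.card (Valued.ResidueField (w.1.adicCompletion L)) : ℕ) : ℂ) = (Ideal.absNorm v.asIdeal : ℂ) := by
    congr 1
    rw [Fintype.card_eq_nat_card, ← natCard_residueField_eq_of_compatible, natCard_residueField_eq_of_ramified (IsCMField.complexConj L) v hc1 w hw he,
      Ideal.absNorm_apply, Submodule.cardQuot_apply]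
  obtain ⟨ε, hεv, hε⟩ := exists_residual_nonsquare_unit (K := (w.1.adicCompletion L)) h2v
  have hϖ0 : ϖ ≠ 0 := fun h0 => by rw [h0, map_zero] at hϖ; exact WithZero.coe_ne_zero hϖ.symm
  have hn2 : 2 ≤ n := typeTwo_two_le_n_of_even_ram L w hw he h2 ϖ hϖ hσϖ hblk hirr hdisc hn
  -- the centring unit `s` (`s·û₀₀ = 1`, `|s| = 1`) and A-p12's conjugator `k` putting `B₀ = k⁻¹(s·ĝ_w)k` at depth `2n − 1` ((h1) ★ p849294, even head)
  obtain ⟨s, hs⟩ := exists_units_mul_oneByOne_eq_one ((localNonsplitEquiv (IsCMField.complexConj L) (Matrix.of fun i j : Fin 1 => if i.val + j.val + 1 = 1 then (1 : L) else 0) (IsCMField.complexConj_ne_one L) w hw γH.2).val : GL (Fin 1) (w.1.adicCompletion L))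
  have hu1 := v_oneByOne_eq_one_of_local L w hw γH.2
  have hsv : Valued.v (s : w.1.adicCompletion L) = 1 := by
    have h := congrArg Valued.v hs
    rwa [map_mul, hu1, mul_one, map_one] at h
  obtain ⟨k, hk, hdk⟩ := exists_centre_forall_v_rerootedCentred_sub_one_le_of_even_ram L w hw he h2 ϖ hϖ hσϖ γH hblk hu2 hirr hdisc hn m hm β hβ s hs
  have hd := hdk (2 * n - 1) (by omega) (by omega)
  -- the re-rooted literal `γ′ = ι(B₀, 1)`
  obtain ⟨γ', hγ'⟩ : ∃ γ' : unitaryGroupOfForm (galAdicCompletionMap (L := L) (IsCMField.complexConj L) hw) ((StdForm.antidiagonal 3).over (w.1.adicCompletion L)),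
      (γ' : GL (Fin 3) (w.1.adicCompletion L)) = endoGL ((k⁻¹ * (Matrix.GeneralLinearGroup.scalar (Fin 2) s * ((localNonsplitEquiv (IsCMField.complexConj L) (Matrix.of fun i j : Fin 2 => if i.val + j.val + 1 = 2 then (1 : L) else 0) (IsCMField.complexConj_ne_one L) w hw γH.1).val : GL (Fin 2) (w.1.adicCompletion L))) * k), (1 : GL (Fin 1) (w.1.adicCompletion L))) :=
    ⟨⟨_, endoGL_rerootedCentred_mem_unitaryGroupOfForm_ram L w hw γH s hs k hk⟩, rfl⟩
  -- `B₀ ∈ U(σ_w, !![0,1;1,0])`, rootless, discriminant depth `2N`, TOP (`|½tr B₀ − 1| ≤ |ϖ^N|`), empty top W-ball (A-p12 ∕ F0P3a-p05 ★, transported as in ★ p849413)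
  have hk' : k ∈ unitaryGroupOfForm (galAdicCompletionMap (L := L) (IsCMField.complexConj L) hw) (!![(0 : w.1.adicCompletion L), 1; 1, 0] : Matrix (Fin 2) (Fin 2) (w.1.adicCompletion L)) := by
    rw [← stdForm_antidiagonal_two_over_eq, ← placeForm_antidiagOne]; exact hk
  have hg' : ((localNonsplitEquiv (IsCMField.complexConj L) (Matrix.of fun i j : Fin 2 => if i.val + j.val + 1 = 2 then (1 : L) else 0) (IsCMField.complexConj_ne_one L) w hw γH.1).val : GL (Fin 2) (w.1.adicCompletion L)) ∈
        unitaryGroupOfForm (galAdicCompletionMap (L := L) (IsCMField.complexConj L) hw) (!![(0 : w.1.adicCompletion L), 1; 1, 0] : Matrix (Fin 2) (Fin 2) (w.1.adicCompletion L)) := by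
    rw [← stdForm_antidiagonal_two_over_eq, ← placeForm_antidiagOne]
    exact (localNonsplitEquiv (IsCMField.complexConj L) _ (IsCMField.complexConj_ne_one L) w hw γH.1).2
  have hγU : (k⁻¹ * (Matrix.GeneralLinearGroup.scalar (Fin 2) s * ((localNonsplitEquiv (IsCMField.complexConj L) (Matrix.of fun i j : Fin 2 => if i.val + j.val + 1 = 2 then (1 : L) else 0) (IsCMField.complexConj_ne_one L) w hw γH.1).val : GL (Fin 2) (w.1.adicCompletion L))) * k) ∈
        unitaryGroupOfForm (galAdicCompletionMap (L := L) (IsCMField.complexConj L) hw) (!![(0 : w.1.adicCompletion L), 1; 1, 0] : Matrix (Fin 2) (Fin 2) (w.1.adicCompletion L)) :=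
    Subgroup.mul_mem _ (Subgroup.mul_mem _ (Subgroup.inv_mem _ hk')
      (scalar_mul_mem_unitaryGroupOfForm hg' s (map_mul_self_eq_one_of_mul_oneByOne_eq_one (oneByOne_mem_unitaryGroupOfForm_antidiagonal_of_local L w hw γH.2) hs))) hk'
  have hirrB := not_exists_isRoot_charpoly_rerootedCentred_ram L w hw γH hirr s k
  have hdiscB := (v_disc_rerootedCentred_ram L w hw γH s hs k).trans hdisc
  have hdisc_lt : Valued.v (((((k⁻¹ * (Matrix.GeneralLinearGroup.scalar (Fin 2) s * ((localNonsplitEquiv (IsCMField.complexConj L) (Matrix.of fun i j : Fin 2 => if i.val + j.val + 1 = 2 then (1 : L) else 0) (IsCMField.complexConj_ne_one L) w hw γH.1).val : GL (Fin 2) (w.1.adicCompletion L))) * k) : GL (Fin 2) (w.1.adicCompletion L)) : Matrix (Fin 2) (Fin 2) (w.1.adicCompletion L))).trace ^ 2 -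
      4 * ((((k⁻¹ * (Matrix.GeneralLinearGroup.scalar (Fin 2) s * ((localNonsplitEquiv (IsCMField.complexConj L) (Matrix.of fun i j : Fin 2 => if i.val + j.val + 1 = 2 then (1 : L) else 0) (IsCMField.complexConj_ne_one L) w hw γH.1).val : GL (Fin 2) (w.1.adicCompletion L))) * k) : GL (Fin 2) (w.1.adicCompletion L)) : Matrix (Fin 2) (Fin 2) (w.1.adicCompletion L))).det) < Valued.v ϖ ^ (2 * (2 * n - 1)) := by
    rw [hdiscB, hϖ, ← WithZero.exp_nsmul]
    exact WithZero.exp_lt_exp.2 (by rw [nsmul_eq_mul]; push_cast; omega)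
  obtain ⟨-, -, hA⟩ := typeTwo_depthDictionary_even_ram L w hw he h2 ϖ hϖ hσϖ hblk hu2 hirr hdisc m hm β hβ
  have hlt := (hA hmN).2
  have hα : Valued.v ((((k⁻¹ * (Matrix.GeneralLinearGroup.scalar (Fin 2) s * ((localNonsplitEquiv (IsCMField.complexConj L) (Matrix.of fun i j : Fin 2 => if i.val + j.val + 1 = 2 then (1 : L) else 0) (IsCMField.complexConj_ne_one L) w hw γH.1).val : GL (Fin 2) (w.1.adicCompletion L))) * k) : GL (Fin 2) (w.1.adicCompletion L)) :
          Matrix (Fin 2) (Fin 2) (w.1.adicCompletion L)).trace / 2 - 1) ≤ Valued.v (ϖ ^ (2 * n - 1 + 1)) := by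
    rw [trace_coe_inv_conj_scalar_mul, mul_div_assoc, v_mul_trace_div_two_sub_one_eq h2v hs hsv, coe_localNonsplitEquiv_apply,
      show 2 * n - 1 + 1 = 2 * n by omega]
    exact hlt.le
  have hfin := finite_selfDual_fixed_of_even_depth_ramified L v w hw he h2 (Units.mk0 ϖ hϖ0) hϖ hσϖ γH.1 hirr hdisc hn
  have hzero := ncard_selfDual_fixed_ball_top_of_even_depth_ramified L v w hw he h2 (Units.mk0 ϖ hϖ0) hϖ hσϖ γH.1 hirr hblk hn hdisc
  simp only [Units.val_mk0] at hfin hzero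
  have hempty := (Set.ncard_eq_zero (hfin.subset fun B hB => ⟨by rw [placeForm_antidiagOne, stdForm_antidiagonal_two_over_eq]; exact hB.1, hB.2.1⟩)).1 hzero
  have htop := centredBall_inv_conj_scalar_mul_eq_empty (ϖ := ϖ) _ hk' _ hsv (pow_ne_zero (2 * n) hϖ0) hempty
  rw [show 2 * n = 2 * n - 1 + 1 by omega] at htop
  -- the root region is finite (`#R = q + 1`, ★ p849413)
  have hR := ncard_rootRegion_hyperbolic_of_even_A_ram L w hw he h2 ϖ hϖ hσϖ γH hblk hu2 hirr hdisc hn m hm β hβ s hs k hk γ' hγ' hmN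
  have hRfin := Set.finite_of_ncard_ne_zero (ne_of_eq_of_ne hR (Nat.succ_ne_zero _))
  -- the per-vertex top census (★ glue head, class-blind form) at `c₁ := 1`, then ★ `zhyp_zero_even_A_ram_of_topVertexCensus`
  have hV := hyperbolicVertexCensus_top_sum (K := (w.1.adicCompletion L)) hσσ hvσ hσϖ hϖ hres h2v hnorm γ' _ hγ' hγU (d₀ := 2 * n - 1) (by omega) ⟨n - 1, by omega⟩
    hd hdisc_lt hα htop hRfin 1 ε (by rw [map_one]) hεv hε ⟨-1, by rw [Valuation.mem_integer_iff, Valuation.map_neg, map_one]⟩ rfl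
  exact zhyp_zero_even_A_ram_of_topVertexCensus L w hw he h2 ϖ hϖ hσϖ γH hblk hu2 hirr hdisc hn m hm β hβ s hs k hk (d₀ := 2 * n - 1) (by omega) hd
    γ' hγ' 1 ε (by rw [map_one]) hεv hε _ hq (fun vtx hv => (hV vtx hv).1) (fun vtx hv => (hV vtx hv).2) mA hnA hmN

set_option maxHeartbeats 3200000 in
-- budget only: the keeper's statement-heavy socket text (verbatim) and the token-heavy ★ heads composed.
/-- **THE KEEPER'S CELL `stub_Zhyp_pm_even_A`, CLOSED** (regime A-even, rows `±`, hyperbolic literal, class constant `c` with `red c · red(−det Φ₃,w) = 1`): `#A₊ = #A₋ = (q + 1)∕2 · q^{2mA}` —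
★ `zhyp_pm_even_A_ram_of_topVertexCensus` ∘ ★ `hyperbolicVertexCensus_top` (kind `¬Pin ∧ Qbig_(−c)`) ∘ ★ XIII-b `two_mul_ncard_rootRegion_shell_class_eq_of_top_of_even_depth_ramified` (`c₀ := −c`).
[cite: Rogawski1990, §4.9 Prop. 4.9.1 (a) p. 55, Lemma 4.9.3 p. 56] [cite: Kottwitz1986, §3] [cite: LabesseLanglands1979, §2 Lemma 2.1 p. 8] -/
theorem zhyp_pm_even_A_ram
    (L : Type) [Field L] [NumberField L] [IsCMField L] (H' : Matrix (Fin 3) (Fin 3) L)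
    {v : HeightOneSpectrum (𝓞 ↥(maximalRealSubfield L))}
    (_hH' : (H'.map (cmConjRingHom L)).transpose = H') (w : PlacesOver L v)
    (hw : IsCMField.complexConj L • w.1 = w.1) (he : v.asIdeal.ramificationIdx' w.1.asIdeal ≠ 1)
    (hH'w : IsUnit (placeForm H' w.1)) (_hH'i : hH'w.unit ∈ glInt 3 (w.1.adicCompletion L))
    (h2 : IsUnit (2 : 𝒪[(w.1.adicCompletion L)]))
    (ϖ : w.1.adicCompletion L) (hϖ : Valued.v ϖ = WithZero.exp (-1 : ℤ)) (hσϖ : galAdicCompletionMap (L := L) (IsCMField.complexConj L) hw ϖ = -ϖ)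
    (A : GL (Fin 3) (w.1.adicCompletion L)) (_hA : A ∈ glInt 3 (w.1.adicCompletion L))
    (_hframe : placeForm H' w.1 = (-(placeForm H' w.1).det) • formCongr (galAdicCompletionMap (L := L) (IsCMField.complexConj L) hw) A ((StdForm.antidiagonal 3).over (w.1.adicCompletion L))) :

    ∀ (c : (w.1.adicCompletion L)), Valued.v c ≤ 1 → red c * red (-((placeForm H' w.1)).det) = 1 →
      ∀ ⦃γH : ((cmDatum L 2 (Matrix.of fun i j : Fin 2 => if i.val + j.val + 1 = 2 then (1 : L) else 0)).Local v × (cmDatum L 1 (Matrix.of fun i j : Fin 1 => if i.val + j.val + 1 = 1 then (1 : L) else 0)).Local v)⦄,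
      (∀ i j : Fin 2, Valued.v (((((γH.1.val : GL (Fin 2) (UnitaryGroup.LocalRing L v)).val.map (Pi.evalRingHom (fun w' : PlacesOver L v => w'.1.adicCompletion L) w))) - 1) i j) ≤ Valued.v (ϖ ^ 2)) → Valued.v (finGammaTwo L v γH w - 1) ≤ Valued.v (ϖ ^ 2) → IsLocalGRegular L v γH →
      (¬ ∃ x : (w.1.adicCompletion L), ((((γH.1.val : GL (Fin 2) (UnitaryGroup.LocalRing L v)).val.map (Pi.evalRingHom (fun w' : PlacesOver L v => w'.1.adicCompletion L) w))).charpoly).IsRoot x) → ∀ ⦃n : ℕ⦄,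
      Valued.v ((((γH.1.val : GL (Fin 2) (UnitaryGroup.LocalRing L v)).val.map (Pi.evalRingHom (fun w' : PlacesOver L v => w'.1.adicCompletion L) w))).trace ^ 2 - 4 * (((γH.1.val : GL (Fin 2) (UnitaryGroup.LocalRing L v)).val.map (Pi.evalRingHom (fun w' : PlacesOver L v => w'.1.adicCompletion L) w))).det) = WithZero.exp (-((2 * (2 * n) : ℕ) : ℤ)) → 1 ≤ n →
      ∀ (m : ℕ), Valued.v (((finCharpolyTwo L v γH).eval (finGammaTwo L v γH)) w) =
          Valued.v ((toPlace v w (HeckeCharacter.uniformizer ↥(maximalRealSubfield L) v : v.adicCompletion ↥(maximalRealSubfield L))) ^ m) →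
        ∀ β : (v.adicCompletion ↥(maximalRealSubfield L))ˣ, toPlace v w (β : v.adicCompletion ↥(maximalRealSubfield L)) =
          -(((finCharpolyTwo L v γH).eval (finGammaTwo L v γH)) w *
              (finGammaTwo L v γH w ^ 2 +
                ((γH.1.val.val : Matrix (Fin 2) (Fin 2) (LocalRing L v)).map (Pi.evalRingHom (fun w' : PlacesOver L v => w'.1.adicCompletion L) w)).det)) /
            (2 * finGammaTwo L v γH w ^ 2 *
              ((γH.1.val.val : Matrix (Fin 2) (Fin 2) (LocalRing L v)).map (Pi.evalRingHom (fun w' : PlacesOver L v => w'.1.adicCompletion L) w)).det) →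
        ∀ (P₁ : GL (Fin 3) (w.1.adicCompletion L)) (d : Fin 2 → (w.1.adicCompletion L)) (η : (w.1.adicCompletion L)) (γ₁ : GL (Fin 2) (w.1.adicCompletion L)),
        P₁ ∈ glInt 3 (w.1.adicCompletion L) →
        formCongr (galAdicCompletionMap (L := L) (IsCMField.complexConj L) hw) P₁ (placeForm (Matrix.of fun i j : Fin 3 => if i.val + j.val + 1 = 3 then (1 : L) else 0) w.1) = !![(Matrix.diagonal d) 0 0, 0, (Matrix.diagonal d) 0 1; 0, η, 0; (Matrix.diagonal d) 1 0, 0, (Matrix.diagonal d) 1 1] →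
        (∀ i, Valued.v (d i) = 1) → (∀ i, (galAdicCompletionMap (L := L) (IsCMField.complexConj L) hw) (d i) = d i) →
        (∀ z : (w.1.adicCompletion L), Valued.v z ≤ 1 → Valued.v (d 0 + d 1 * ((galAdicCompletionMap (L := L) (IsCMField.complexConj L) hw) z * z)) = 1) →
        (∀ z : (w.1.adicCompletion L), Valued.v z ≤ 1 → Valued.v (d 0 * ((galAdicCompletionMap (L := L) (IsCMField.complexConj L) hw) z * z) + d 1) = 1) →
        (galAdicCompletionMap (L := L) (IsCMField.complexConj L) hw) η = η → Valued.v η = 1 →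
        (∀ i j, Valued.v (((γ₁ : Matrix (Fin 2) (Fin 2) (w.1.adicCompletion L)) - 1) i j) ≤ Valued.v (ϖ ^ 2)) →
        γ₁ ∈ unitaryGroupOfForm (galAdicCompletionMap (L := L) (IsCMField.complexConj L) hw) (Matrix.diagonal d) →
        (γ₁ : Matrix (Fin 2) (Fin 2) (w.1.adicCompletion L)).charpoly = (((γH.1.val : GL (Fin 2) (UnitaryGroup.LocalRing L v)).val.map (Pi.evalRingHom (fun w' : PlacesOver L v => w'.1.adicCompletion L) w))).charpoly →
        Valued.v ((γ₁ : Matrix (Fin 2) (Fin 2) (w.1.adicCompletion L)).trace ^ 2 - 4 * (γ₁ : Matrix (Fin 2) (Fin 2) (w.1.adicCompletion L)).det) = WithZero.exp (-((2 * (2 * n) : ℕ) : ℤ)) →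
        (¬ ∃ x : (w.1.adicCompletion L), ((γ₁ : Matrix (Fin 2) (Fin 2) (w.1.adicCompletion L)).charpoly).IsRoot x) →
        (¬ ∃ t : (w.1.adicCompletion L), t * (galAdicCompletionMap (L := L) (IsCMField.complexConj L) hw) t = η) →
          ∀ (mA : ℕ), n = mA + 1 → m = 2 * n →
          ({M : Submodule (Valued.integer (w.1.adicCompletion L)) (Fin 3 → (w.1.adicCompletion L)) | IsSelfDualLattice (galAdicCompletionMap (L := L) (IsCMField.complexConj L) hw) ϖ (placeForm (Matrix.of fun i j : Fin 3 => if i.val + j.val + 1 = 3 then (1 : L) else 0) w.1) M ∧ mapGL (endoGL (((localNonsplitEquiv (IsCMField.complexConj L) (Matrix.of fun i j : Fin 2 => if i.val + j.val + 1 = 2 then (1 : L) else 0) (IsCMField.complexConj_ne_one L) w hw γH.1).val : GL (Fin 2) (w.1.adicCompletion L)), ((localNonsplitEquiv (IsCMField.complexConj L) (Matrix.of fun i j : Fin 1 => if i.val + j.val + 1 = 1 then (1 : L) else 0) (IsCMField.complexConj_ne_one L) w hw γH.2).val : GL (Fin 1) (w.1.adicCompletion L)))) M = M ∧ (M.map ((Matrix.toLin'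 (((endoGL (((localNonsplitEquiv (IsCMField.complexConj L) (Matrix.of fun i j : Fin 2 => if i.val + j.val + 1 = 2 then (1 : L) else 0) (IsCMField.complexConj_ne_one L) w hw γH.1).val : GL (Fin 2) (w.1.adicCompletion L)), ((localNonsplitEquiv (IsCMField.complexConj L) (Matrix.of fun i j : Fin 1 => if i.val + j.val + 1 = 1 then (1 : L) else 0) (IsCMField.complexConj_ne_one L) w hw γH.2).val : GL (Fin 1) (w.1.adicCompletion L))) : GL (Fin 3) (w.1.adicCompletion L)) : Matrix (Fin 3) (Fin 3) (w.1.adicCompletion L)) - 1)).restrictScalars (Valued.integer (w.1.adicCompletion L))) ≤ scaleLattice ϖ M ∧ ¬ M.map ((Matrix.toLin' (((endoGL (((localNonsplitEquiv (IsCMField.complexConj L) (Matrix.of fun i j : Fin 2 => if i.val + j.val + 1 = 2 then (1 : L) else 0) (IsCMField.complexConj_ne_one L) w hw γH.1).val : GL (Fin 2) (w.1.adicCompletion L)), ((localNonsplitEquiv (IsCMField.complexConj L) (Matrix.of fun i j : Fin 1 => if i.val + j.val + 1 = 1 then (1 : L) else 0) (IsCMField.complexConj_ne_one L) w hw γH.2).val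 : GL (Fin 1) (w.1.adicCompletion L))) : GL (Fin 3) (w.1.adicCompletion L)) : Matrix (Fin 3) (Fin 3) (w.1.adicCompletion L)) - 1)).restrictScalars (Valued.integer (w.1.adicCompletion L))) ≤ scaleLattice (ϖ ^ 2) M ∧ M.map ((Matrix.toLin' ((((endoGL (((localNonsplitEquiv (IsCMField.complexConj L) (Matrix.of fun i j : Fin 2 => if i.val + j.val + 1 = 2 then (1 : L) else 0) (IsCMField.complexConj_ne_one L) w hw γH.1).val : GL (Fin 2) (w.1.adicCompletion L)), ((localNonsplitEquiv (IsCMField.complexConj L) (Matrix.of fun i j : Fin 1 => if i.val + j.val + 1 = 1 then (1 : L) else 0) (IsCMField.complexConj_ne_one L) w hw γH.2).val : GL (Fin 1) (w.1.adicCompletion L))) : GL (Fin 3) (w.1.adicCompletion L)) : Matrix (Fin 3) (Fin 3) (w.1.adicCompletion L)) - 1) ^ 2)).restrictScalars (Valued.integer (w.1.adicCompletion L))) ≤ scaleLattice (ϖ ^ 3) M ∧ ∃ y ∈ M, ∃ a : (w.1.adicCompletion L), Valued.v a = 1 ∧ Valued.v (ϖ⁻¹ * pairing (galAdicCompletionMap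 (L := L) (IsCMField.complexConj L) hw) (placeForm (Matrix.of fun i j : Fin 3 => if i.val + j.val + 1 = 3 then (1 : L) else 0) w.1) y ((((endoGL (((localNonsplitEquiv (IsCMField.complexConj L) (Matrix.of fun i j : Fin 2 => if i.val + j.val + 1 = 2 then (1 : L) else 0) (IsCMField.complexConj_ne_one L) w hw γH.1).val : GL (Fin 2) (w.1.adicCompletion L)), ((localNonsplitEquiv (IsCMField.complexConj L) (Matrix.of fun i j : Fin 1 => if i.val + j.val + 1 = 1 then (1 : L) else 0) (IsCMField.complexConj_ne_one L) w hw γH.2).val : GL (Fin 1) (w.1.adicCompletion L))) : GL (Fin 3) (w.1.adicCompletion L)) : Matrix (Fin 3) (Fin 3) (w.1.adicCompletion L)) - 1) *ᵥ y) - c * a ^ 2) < 1)}.ncard : ℂ) =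
            ((Ideal.absNorm v.asIdeal : ℂ) + 1) / 2 * (Ideal.absNorm v.asIdeal : ℂ) ^ (2 * mA) ∧
          ({M : Submodule (Valued.integer (w.1.adicCompletion L)) (Fin 3 → (w.1.adicCompletion L)) | IsSelfDualLattice (galAdicCompletionMap (L := L) (IsCMField.complexConj L) hw) ϖ (placeForm (Matrix.of fun i j : Fin 3 => if i.val + j.val + 1 = 3 then (1 : L) else 0) w.1) M ∧ mapGL (endoGL (((localNonsplitEquiv (IsCMField.complexConj L) (Matrix.of fun i j : Fin 2 => if i.val + j.val + 1 = 2 then (1 : L) else 0) (IsCMField.complexConj_ne_one L) w hw γH.1).val : GL (Fin 2) (w.1.adicCompletion L)), ((localNonsplitEquiv (IsCMField.complexConj L) (Matrix.of fun i j : Fin 1 => if i.val + j.val + 1 = 1 then (1 : L) else 0) (IsCMField.complexConj_ne_one L) w hw γH.2).val : GL (Fin 1) (w.1.adicCompletion L)))) M = M ∧ (M.map ((Matrix.toLin' (((endoGL (((localNonsplitEquiv (IsCMField.complexConj L) (Matrix.of fun i j : Fin 2 => if i.val + j.val + 1 = 2 then (1 : L) else 0) (IsCMField.complexConj_ne_one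 L) w hw γH.1).val : GL (Fin 2) (w.1.adicCompletion L)), ((localNonsplitEquiv (IsCMField.complexConj L) (Matrix.of fun i j : Fin 1 => if i.val + j.val + 1 = 1 then (1 : L) else 0) (IsCMField.complexConj_ne_one L) w hw γH.2).val : GL (Fin 1) (w.1.adicCompletion L))) : GL (Fin 3) (w.1.adicCompletion L)) : Matrix (Fin 3) (Fin 3) (w.1.adicCompletion L)) - 1)).restrictScalars (Valued.integer (w.1.adicCompletion L))) ≤ scaleLattice ϖ M ∧ ¬ M.map ((Matrix.toLin' (((endoGL (((localNonsplitEquiv (IsCMField.complexConj L) (Matrix.of fun i j : Fin 2 => if i.val + j.val + 1 = 2 then (1 : L) else 0) (IsCMField.complexConj_ne_one L) w hw γH.1).val : GL (Fin 2) (w.1.adicCompletion L)), ((localNonsplitEquiv (IsCMField.complexConj L) (Matrix.of fun i j : Fin 1 => if i.val + j.val + 1 = 1 then (1 : L) else 0) (IsCMField.complexConj_ne_one L) w hw γH.2).val : GL (Fin 1) (w.1.adicCompletion L))) : GL (Fin 3) (w.1.adicCompletion L)) : Matrix (Fin 3) (Fin 3) (w.1.adicCompletion L)) - 1)).restrictScalars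 (Valued.integer (w.1.adicCompletion L))) ≤ scaleLattice (ϖ ^ 2) M ∧ M.map ((Matrix.toLin' ((((endoGL (((localNonsplitEquiv (IsCMField.complexConj L) (Matrix.of fun i j : Fin 2 => if i.val + j.val + 1 = 2 then (1 : L) else 0) (IsCMField.complexConj_ne_one L) w hw γH.1).val : GL (Fin 2) (w.1.adicCompletion L)), ((localNonsplitEquiv (IsCMField.complexConj L) (Matrix.of fun i j : Fin 1 => if i.val + j.val + 1 = 1 then (1 : L) else 0) (IsCMField.complexConj_ne_one L) w hw γH.2).val : GL (Fin 1) (w.1.adicCompletion L))) : GL (Fin 3) (w.1.adicCompletion L)) : Matrix (Fin 3) (Fin 3) (w.1.adicCompletion L)) - 1) ^ 2)).restrictScalars (Valued.integer (w.1.adicCompletion L))) ≤ scaleLattice (ϖ ^ 3) M ∧ ¬ ∃ y ∈ M, ∃ a : (w.1.adicCompletion L), Valued.v a = 1 ∧ Valued.v (ϖ⁻¹ * pairing (galAdicCompletionMap (L := L) (IsCMField.complexConj L) hw) (placeForm (Matrix.of fun i j : Fin 3 => if i.val + j.val + 1 = 3 then (1 : L) else 0) w.1) y ((((endoGL (((localNonsplitEquiv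 (IsCMField.complexConj L) (Matrix.of fun i j : Fin 2 => if i.val + j.val + 1 = 2 then (1 : L) else 0) (IsCMField.complexConj_ne_one L) w hw γH.1).val : GL (Fin 2) (w.1.adicCompletion L)), ((localNonsplitEquiv (IsCMField.complexConj L) (Matrix.of fun i j : Fin 1 => if i.val + j.val + 1 = 1 then (1 : L) else 0) (IsCMField.complexConj_ne_one L) w hw γH.2).val : GL (Fin 1) (w.1.adicCompletion L))) : GL (Fin 3) (w.1.adicCompletion L)) : Matrix (Fin 3) (Fin 3) (w.1.adicCompletion L)) - 1) *ᵥ y) - c * a ^ 2) < 1)}.ncard : ℂ) =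
            ((Ideal.absNorm v.asIdeal : ℂ) + 1) / 2 * (Ideal.absNorm v.asIdeal : ℂ) ^ (2 * mA) := by
  intro c _hcv hcred γH hblk hu2 _hreg hirr n hdisc hn m hm β hβ _P₁ _d _η _γ₁ _hP₁ _hform _hd1 _hdσ _han₀ _han₁ _hση _hηv _hγ2 _hγU _hχ _hdiscγ _hirrγ _hηN mA hnA hmN
  classical
  -- THE CM DRESS: `σ_w` an involution preserving `|·|`, residually trivial with norms, `|2| = 1`, PIR integers, `#𝓀_w = N(v)`, a residual non-square `ε`
  have hc1 : IsCMField.complexConj L ≠ 1 := IsCMField.complexConj_ne_one L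
  have h2v : Valued.v (2 : (w.1.adicCompletion L)) = 1 := (isUnit_two_integer_iff_valued_eq_one L w.1).1 h2
  have hσσ : ∀ z : (w.1.adicCompletion L), (galAdicCompletionMap (L := L) (IsCMField.complexConj L) hw) ((galAdicCompletionMap (L := L) (IsCMField.complexConj L) hw) z) = z :=
    galAdicCompletionMap_galAdicCompletionMap_of_smul_eq (IsCMField.complexConj L) w hc1 hw
  have hvσ : ∀ z : (w.1.adicCompletion L), Valued.v ((galAdicCompletionMap (L := L) (IsCMField.complexConj L) hw) z) = Valued.v z := fun z =>
    valued_galAdicCompletionMap (L := L) (IsCMField.complexConj L) hw z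
  obtain ⟨-, -, -, hres, hnorm⟩ := ramifiedBlock_adicCompletion L v w hw he h2v
  haveI : Fintype (Valued.ResidueField (w.1.adicCompletion L)) := Fintype.ofFinite _
  haveI := isPrincipalIdealRing_integer_adicCompletion L v w
  have hq : ((Fintype.card (Valued.ResidueField (w.1.adicCompletion L)) : ℕ) : ℂ) = (Ideal.absNorm v.asIdeal : ℂ) := by
    congr 1
    rw [Fintype.card_eq_nat_card, ← natCard_residueField_eq_of_compatible, natCard_residueField_eq_of_ramified (IsCMField.complexConj L) v hc1 w hw he,
      Ideal.absNorm_apply, Submodule.cardQuot_apply]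
  obtain ⟨ε, hεv, hε⟩ := exists_residual_nonsquare_unit (K := (w.1.adicCompletion L)) h2v
  have hϖ0 : ϖ ≠ 0 := fun h0 => by rw [h0, map_zero] at hϖ; exact WithZero.coe_ne_zero hϖ.symm
  have hn2 : 2 ≤ n := typeTwo_two_le_n_of_even_ram L w hw he h2 ϖ hϖ hσϖ hblk hirr hdisc hn
  -- the centring unit `s` (`s·û₀₀ = 1`, `|s| = 1`) and A-p12's conjugator `k` putting `B₀ = k⁻¹(s·ĝ_w)k` at depth `2n − 1` ((h1) ★ p849294, even head)
  obtain ⟨s, hs⟩ := exists_units_mul_oneByOne_eq_one ((localNonsplitEquiv (IsCMField.complexConj L) (Matrix.of fun i j : Fin 1 => if i.val + j.val + 1 = 1 then (1 : L) else 0) (IsCMField.complexConj_ne_one L) w hw γH.2).val : GL (Fin 1) (w.1.adicCompletion L))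
  have hu1 := v_oneByOne_eq_one_of_local L w hw γH.2
  have hsv : Valued.v (s : w.1.adicCompletion L) = 1 := by
    have h := congrArg Valued.v hs
    rwa [map_mul, hu1, mul_one, map_one] at h
  obtain ⟨k, hk, hdk⟩ := exists_centre_forall_v_rerootedCentred_sub_one_le_of_even_ram L w hw he h2 ϖ hϖ hσϖ γH hblk hu2 hirr hdisc hn m hm β hβ s hs
  have hd := hdk (2 * n - 1) (by omega) (by omega)
  -- the re-rooted literal `γ′ = ι(B₀, 1)`
  obtain ⟨γ', hγ'⟩ : ∃ γ' : unitaryGroupOfForm (galAdicCompletionMap (L := L) (IsCMField.complexConj L) hw) ((StdForm.antidiagonal 3).over (w.1.adicCompletion L)),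
      (γ' : GL (Fin 3) (w.1.adicCompletion L)) = endoGL ((k⁻¹ * (Matrix.GeneralLinearGroup.scalar (Fin 2) s * ((localNonsplitEquiv (IsCMField.complexConj L) (Matrix.of fun i j : Fin 2 => if i.val + j.val + 1 = 2 then (1 : L) else 0) (IsCMField.complexConj_ne_one L) w hw γH.1).val : GL (Fin 2) (w.1.adicCompletion L))) * k), (1 : GL (Fin 1) (w.1.adicCompletion L))) :=
    ⟨⟨_, endoGL_rerootedCentred_mem_unitaryGroupOfForm_ram L w hw γH s hs k hk⟩, rfl⟩
  -- `B₀ ∈ U(σ_w, !![0,1;1,0])`, rootless, discriminant depth `2N`, TOP (`|½tr B₀ − 1| ≤ |ϖ^N|`), empty top W-ball (A-p12 ∕ F0P3a-p05 ★, transported as in ★ p849413)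
  have hk' : k ∈ unitaryGroupOfForm (galAdicCompletionMap (L := L) (IsCMField.complexConj L) hw) (!![(0 : w.1.adicCompletion L), 1; 1, 0] : Matrix (Fin 2) (Fin 2) (w.1.adicCompletion L)) := by
    rw [← stdForm_antidiagonal_two_over_eq, ← placeForm_antidiagOne]; exact hk
  have hg' : ((localNonsplitEquiv (IsCMField.complexConj L) (Matrix.of fun i j : Fin 2 => if i.val + j.val + 1 = 2 then (1 : L) else 0) (IsCMField.complexConj_ne_one L) w hw γH.1).val : GL (Fin 2) (w.1.adicCompletion L)) ∈
        unitaryGroupOfForm (galAdicCompletionMap (L := L) (IsCMField.complexConj L) hw) (!![(0 : w.1.adicCompletion L), 1; 1, 0] : Matrix (Fin 2) (Fin 2) (w.1.adicCompletion L)) := by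
    rw [← stdForm_antidiagonal_two_over_eq, ← placeForm_antidiagOne]
    exact (localNonsplitEquiv (IsCMField.complexConj L) _ (IsCMField.complexConj_ne_one L) w hw γH.1).2
  have hγU : (k⁻¹ * (Matrix.GeneralLinearGroup.scalar (Fin 2) s * ((localNonsplitEquiv (IsCMField.complexConj L) (Matrix.of fun i j : Fin 2 => if i.val + j.val + 1 = 2 then (1 : L) else 0) (IsCMField.complexConj_ne_one L) w hw γH.1).val : GL (Fin 2) (w.1.adicCompletion L))) * k) ∈
        unitaryGroupOfForm (galAdicCompletionMap (L := L) (IsCMField.complexConj L) hw) (!![(0 : w.1.adicCompletion L), 1; 1, 0] : Matrix (Fin 2) (Fin 2) (w.1.adicCompletion L)) :=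
    Subgroup.mul_mem _ (Subgroup.mul_mem _ (Subgroup.inv_mem _ hk')
      (scalar_mul_mem_unitaryGroupOfForm hg' s (map_mul_self_eq_one_of_mul_oneByOne_eq_one (oneByOne_mem_unitaryGroupOfForm_antidiagonal_of_local L w hw γH.2) hs))) hk'
  have hirrB := not_exists_isRoot_charpoly_rerootedCentred_ram L w hw γH hirr s k
  have hdiscB := (v_disc_rerootedCentred_ram L w hw γH s hs k).trans hdisc
  have hdisc_lt : Valued.v (((((k⁻¹ * (Matrix.GeneralLinearGroup.scalar (Fin 2) s * ((localNonsplitEquiv (IsCMField.complexConj L) (Matrix.of fun i j : Fin 2 => if i.val + j.val + 1 = 2 then (1 : L) else 0) (IsCMField.complexConj_ne_one L) w hw γH.1).val : GL (Fin 2) (w.1.adicCompletion L))) * k) : GL (Fin 2) (w.1.adicCompletion L)) : Matrix (Fin 2) (Fin 2) (w.1.adicCompletion L))).trace ^ 2 -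
      4 * ((((k⁻¹ * (Matrix.GeneralLinearGroup.scalar (Fin 2) s * ((localNonsplitEquiv (IsCMField.complexConj L) (Matrix.of fun i j : Fin 2 => if i.val + j.val + 1 = 2 then (1 : L) else 0) (IsCMField.complexConj_ne_one L) w hw γH.1).val : GL (Fin 2) (w.1.adicCompletion L))) * k) : GL (Fin 2) (w.1.adicCompletion L)) : Matrix (Fin 2) (Fin 2) (w.1.adicCompletion L))).det) < Valued.v ϖ ^ (2 * (2 * n - 1)) := by
    rw [hdiscB, hϖ, ← WithZero.exp_nsmul]
    exact WithZero.exp_lt_exp.2 (by rw [nsmul_eq_mul]; push_cast; omega)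
  obtain ⟨-, -, hA⟩ := typeTwo_depthDictionary_even_ram L w hw he h2 ϖ hϖ hσϖ hblk hu2 hirr hdisc m hm β hβ
  have hlt := (hA hmN).2
  have hα : Valued.v ((((k⁻¹ * (Matrix.GeneralLinearGroup.scalar (Fin 2) s * ((localNonsplitEquiv (IsCMField.complexConj L) (Matrix.of fun i j : Fin 2 => if i.val + j.val + 1 = 2 then (1 : L) else 0) (IsCMField.complexConj_ne_one L) w hw γH.1).val : GL (Fin 2) (w.1.adicCompletion L))) * k) : GL (Fin 2) (w.1.adicCompletion L)) :
          Matrix (Fin 2) (Fin 2) (w.1.adicCompletion L)).trace / 2 - 1) ≤ Valued.v (ϖ ^ (2 * n - 1 + 1)) := by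
    rw [trace_coe_inv_conj_scalar_mul, mul_div_assoc, v_mul_trace_div_two_sub_one_eq h2v hs hsv, coe_localNonsplitEquiv_apply,
      show 2 * n - 1 + 1 = 2 * n by omega]
    exact hlt.le
  have hfin := finite_selfDual_fixed_of_even_depth_ramified L v w hw he h2 (Units.mk0 ϖ hϖ0) hϖ hσϖ γH.1 hirr hdisc hn
  have hzero := ncard_selfDual_fixed_ball_top_of_even_depth_ramified L v w hw he h2 (Units.mk0 ϖ hϖ0) hϖ hσϖ γH.1 hirr hblk hn hdisc
  simp only [Units.val_mk0] at hfin hzero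
  have hempty := (Set.ncard_eq_zero (hfin.subset fun B hB => ⟨by rw [placeForm_antidiagOne, stdForm_antidiagonal_two_over_eq]; exact hB.1, hB.2.1⟩)).1 hzero
  have htop := centredBall_inv_conj_scalar_mul_eq_empty (ϖ := ϖ) _ hk' _ hsv (pow_ne_zero (2 * n) hϖ0) hempty
  rw [show 2 * n = 2 * n - 1 + 1 by omega] at htop
  -- the root region is finite (`#R = q + 1`, ★ p849413)
  have hR := ncard_rootRegion_hyperbolic_of_even_A_ram L w hw he h2 ϖ hϖ hσϖ γH hblk hu2 hirr hdisc hn m hm β hβ s hs k hk γ' hγ' hmN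
  have hRfin := Set.finite_of_ncard_ne_zero (ne_of_eq_of_ne hR (Nat.succ_ne_zero _))
  -- the class constant `c` is a unit; `nc = −c ∈ 𝒪`
  have hc : Valued.v c = 1 := (v_eq_one_iff_valuation_eq_one c).2 ((red_ne_zero_iff_valuation_eq_one c).1 (left_ne_zero_of_mul_eq_one hcred))
  set nc : Valued.integer (w.1.adicCompletion L) := ⟨-c, by rw [Valuation.mem_integer_iff, Valuation.map_neg, hc]⟩ with hnc_def
  have hncv : Valued.v (nc : (w.1.adicCompletion L)) = 1 := by rw [hnc_def, Valuation.map_neg, hc]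
  -- the per-vertex top census (★ glue head) at `c₁ := c`, the kind count ★ XIII-b (F0P3a-p05 (g18)) at `c₀ := ↑nc`, then ★ `zhyp_pm_even_A_ram_of_topVertexCensus`
  have hV := hyperbolicVertexCensus_top (K := (w.1.adicCompletion L)) hσσ hvσ hσϖ hϖ hres h2v hnorm γ' _ hγ' hγU (d₀ := 2 * n - 1) (by omega) ⟨n - 1, by omega⟩
    hd hdisc_lt hα htop hRfin c ε hc hεv hε nc rfl
  have hXIII := two_mul_ncard_rootRegion_shell_class_eq_of_top_of_even_depth_ramified L v w hw he h2 (Units.mk0 ϖ hϖ0) hϖ hσϖ γ' _ hγ' hγU hirrB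
    hdiscB hn (d₀ := 2 * n - 1) (by omega) hα (nc : (w.1.adicCompletion L)) ε hncv hεv hε
  simp only [Units.val_mk0] at hXIII
  exact zhyp_pm_even_A_ram_of_topVertexCensus L w hw he h2 ϖ hϖ hσϖ γH hblk hu2 hirr hdisc hn m hm β hβ s hs k hk (d₀ := 2 * n - 1) (by omega) hd
    γ' hγ' c ε hc hεv hε _ hq _ hXIII (fun vtx hv => (hV vtx hv).1) (fun vtx hv hQ => ((hV vtx hv).2.1 hQ).1) (fun vtx hv hQ => ((hV vtx hv).2.2 hQ).1)
    (fun vtx hv hQ => ((hV vtx hv).2.1 hQ).2) (fun vtx hv hQ => ((hV vtx hv).2.2 hQ).2) mA hnA hmN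

end Literature.NumberTheory.Rogawski1990.BlockLawHyp

end
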